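import Literature.Topology.FourManifolds.SphereProductThomFundamentalClass
import Literature.Topology.FourManifolds.SphereProductTubeTopology
import Literature.Topology.FourManifolds.SphereProductMiddleHomology
import HarnessLib

/-!
# The open tube of the diagonal of `Sᵏ × Sᵏ`: homotopy type and the generator of its `Hₖ`

Topic `Literature/Topology/FourManifolds` (fact seat of
`Literature.Topology.FourManifolds.HomotopySphere.exists_intersectionForm_equivalent_e8Form`,
Kosinski's `E₈` plumbing, *Differential Manifolds* (1993), VI.12). Companion of
`SphereProductTubeTopology.lean` (the compact tube `N_c = {⟪p, q⟫ ≥ c}` deformation retracts onto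
the diagonal) for the OPEN tube `N_c° = {⟪p, q⟫ > c}` of `SphereProductThomFundamentalClass.lean`
(`SphereProd.openTube`), the open piece of the plumbing: the same great-circle homotopy
`(p, q) ↦ (p, p)` runs inside `N_c°` (`inner_interp_ge`), so

* `SphereProd.OpenTube.exists_homotopyEquiv_sphere`, `…isIso_map_diag`, `…isIso_map_fst` — the
  diagonal `p ↦ (p, p)` is a homotopy equivalence `Sᵏ ≃ N_c°` with inverse `(p, q) ↦ p`
  (`-1 ≤ c < 1`), an isomorphism on homology;
* `SphereProd.OpenTube.exists_eq_zsmul_map_diag` — **`Hₖ(N_c°; ℤ) = ℤ · diag₊[S]`**: since every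
  class of `Hₖ(Sᵏ; ℤ)` is a multiple of the fundamental class `[S] = (μS hk).fundamentalClass`
  (`SphereProd.exists_eq_smul_fundamentalClass_sphere` of `SphereProductCohomology.lean`), the same
  holds for every space receiving a map from `Sᵏ` that is a homology isomorphism in degree `k`
  (`exists_eq_zsmul_map_of_isIso`), e.g. an open piece `Uᵥ ≅ N_c°` of the plumbing — the
  hypothesis `Hₖ(Uᵥ) = ℤ gᵥ` of the Kronecker form of the `E₈` table
  (`HomotopySpheresE8KroneckerTable.lean`).

Everything is proved; no definitions, no named facts (D-0026).

## References

* A. Kosinski, *Differential Manifolds* (1993), VI.12 (the pieces of `M(4n)`). [Kosinski1993]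
* J. Milnor, J. Stasheff, *Characteristic classes* (1974), §11 Thm. 11.1 (the tubular
  neighbourhood of the diagonal). [MilnorStasheff1974]
* A. Hatcher, *Algebraic Topology* (2002), Cor. 2.11, Cor. 2.14, Example 3.11. [HatcherAT2002]
-/

open scoped Manifold ContDiff Topology RealInnerProductSpace
open Set Function CategoryTheory CategoryTheory.Limits

noncomputable section

namespace Literature.Topology.FourManifolds

open Literature.AlgebraicTopology.SingularHomology

namespace SphereProd

variable {k : ℕ}

/-! ### Transport of the generator `[Sᵏ]` of `Hₖ(Sᵏ; ℤ)` -/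

/-- **Transport of the generator**: if `f : Sᵏ → U` is an isomorphism on `Hₖ` (e.g. a homotopy
equivalence), then `Hₖ(U; ℤ) = ℤ · f₊[S]`. [cite: HatcherAT2002, Cor. 2.11] -/
theorem exists_eq_zsmul_map_of_isIso (hk : 2 ≤ k) {U : Type} [TopologicalSpace U]
    (f : C(Metric.sphere (0 : EuclideanSpace ℝ (Fin (k + 1))) 1, U))
    [IsIso (singularHomology.map ℤ ℤ f k)] (y : singularHomology ℤ ℤ U k) :
    ∃ m : ℤ, y = m • singularHomology.map ℤ ℤ f k (μS hk).fundamentalClass := by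
  obtain ⟨x, rfl⟩ : ∃ x, singularHomology.map ℤ ℤ f k x = y :=
    ⟨inv (singularHomology.map ℤ ℤ f k) y, by
      rw [← ModuleCat.comp_apply, IsIso.inv_hom_id, ModuleCat.id_apply]⟩
  obtain ⟨m, rfl⟩ := exists_eq_smul_fundamentalClass_sphere hk x
  exact ⟨m, by rw [map_zsmul]⟩

/-! ### The open tube deformation retracts onto the diagonal -/

namespace OpenTube

variable {c : ℝ}

/-- **The diagonal is a homotopy equivalence `Sᵏ ≃ N_c°`** with homotopy inverse the first
projection (`-1 ≤ c < 1`): `(p, q) ↦ (p, (1 - t) p + t q / ‖·‖)` runs inside the open tube since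
`⟪p, v⟫ ≥ ⟪p, q⟫ ‖v‖` (`inner_interp_ge`). [cite: MilnorStasheff1974, §11 Thm. 11.1] [cite: HatcherAT2002, Cor. 2.11] -/
theorem exists_homotopyEquiv_sphere (hc0 : -1 ≤ c) (hc1 : c < 1) :
    ∃ e : ContinuousMap.HomotopyEquiv ↥(openTube k c)
        (Metric.sphere (0 : EuclideanSpace ℝ (Fin (k + 1))) 1),
      (∀ y, e y = y.1.1) ∧ ∀ p, e.invFun p = ⟨(p, p), diagonal_subset_openTube hc1 rfl⟩ := by
  -- the two maps
  set f : C(↥(openTube k c), Metric.sphere (0 : EuclideanSpace ℝ (Fin (k + 1))) 1) :=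
    ⟨fun y => y.1.1, continuous_fst.comp continuous_subtype_val⟩ with hf
  set g : C(Metric.sphere (0 : EuclideanSpace ℝ (Fin (k + 1))) 1, ↥(openTube k c)) :=
    ⟨fun p => ⟨(p, p), diagonal_subset_openTube hc1 rfl⟩, by fun_prop⟩ with hg
  -- the chord from `p` to `q`, normalised
  have hgt : ∀ y : ↥(openTube k c),
      -1 < ⟪(y.1.1 : EuclideanSpace ℝ (Fin (k + 1))), (y.1.2 : EuclideanSpace ℝ (Fin (k + 1)))⟫ :=
    fun y => hc0.trans_lt y.2
  have hv0 : ∀ (t : unitInterval) (y : ↥(openTube k c)),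
      0 < ‖(1 - (t : ℝ)) • (y.1.1 : EuclideanSpace ℝ (Fin (k + 1))) +
        (t : ℝ) • (y.1.2 : EuclideanSpace ℝ (Fin (k + 1)))‖ := fun t y =>
    norm_interp_pos _ _ (norm_eq_of_mem_sphere _) (norm_eq_of_mem_sphere _) (hgt y) t.2.1 t.2.2
  set V : unitInterval × ↥(openTube k c) → EuclideanSpace ℝ (Fin (k + 1)) := fun ty =>
    (1 - (ty.1 : ℝ)) • (ty.2.1.1 : EuclideanSpace ℝ (Fin (k + 1))) +
      (ty.1 : ℝ) • (ty.2.1.2 : EuclideanSpace ℝ (Fin (k + 1))) with hV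
  have hVc : Continuous V := by
    have hp : Continuous fun ty : unitInterval × ↥(openTube k c) =>
        (ty.2.1.1 : EuclideanSpace ℝ (Fin (k + 1))) := by fun_prop
    have hq : Continuous fun ty : unitInterval × ↥(openTube k c) =>
        (ty.2.1.2 : EuclideanSpace ℝ (Fin (k + 1))) := by fun_prop
    have ht : Continuous fun ty : unitInterval × ↥(openTube k c) => ((ty.1 : ℝ)) :=
      continuous_subtype_val.comp continuous_fst
    exact ((continuous_const.sub ht).smul hp).add (ht.smul hq)
  set γ : unitInterval × ↥(openTube k c) → Metric.sphere (0 : EuclideanSpace ℝ (Fin (k + 1))) 1 :=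
    fun ty => ⟨(‖V ty‖)⁻¹ • V ty, by
      rw [mem_sphere_zero_iff_norm, norm_smul, norm_inv, norm_norm,
        inv_mul_cancel₀ (hv0 ty.1 ty.2).ne']⟩ with hγ
  have hγc : Continuous γ :=
    Continuous.subtype_mk (((continuous_norm.comp hVc).inv₀ fun ty => (hv0 ty.1 ty.2).ne').smul
      hVc) _
  -- it stays in the open tube
  have hmem : ∀ ty : unitInterval × ↥(openTube k c),
      ((ty.2.1.1, γ ty) : (Metric.sphere (0 : EuclideanSpace ℝ (Fin (k + 1))) 1) ×
        (Metric.sphere (0 : EuclideanSpace ℝ (Fin (k + 1))) 1)) ∈ openTube k c := by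
    intro ty
    have hlt := ty.2.2
    have hin := inner_interp_ge (ty.2.1.1 : EuclideanSpace ℝ (Fin (k + 1)))
      (ty.2.1.2 : EuclideanSpace ℝ (Fin (k + 1))) (norm_eq_of_mem_sphere _)
      (norm_eq_of_mem_sphere _) ty.1.2.1 ty.1.2.2
    have hpos := hv0 ty.1 ty.2
    change c < ⟪_, (‖V ty‖)⁻¹ • V ty⟫
    rw [real_inner_smul_right]
    rw [lt_inv_mul_iff₀' ?_] <;> [skip; exact hpos]
    calc c * ‖V ty‖ < ⟪(ty.2.1.1 : EuclideanSpace ℝ (Fin (k + 1))),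
          (ty.2.1.2 : EuclideanSpace ℝ (Fin (k + 1)))⟫ * ‖V ty‖ :=
          mul_lt_mul_of_pos_right hlt hpos
      _ ≤ _ := hin
  -- the homotopy `(p, q) ∼ (p, p)`
  set H : C(unitInterval × ↥(openTube k c), ↥(openTube k c)) :=
    ⟨fun ty => ⟨(ty.2.1.1, γ ty), hmem ty⟩,
      Continuous.subtype_mk ((continuous_subtype_val.comp (continuous_fst.comp
        (continuous_subtype_val.comp continuous_snd))).subtype_mk _ |>.prodMk hγc) _⟩ with hH
  have hH0 : ∀ y, H (0, y) = g (f y) := by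
    intro y
    apply Subtype.ext
    change (y.1.1, γ (0, y)) = (y.1.1, y.1.1)
    congr 1
    apply Subtype.ext
    change (‖V (0, y)‖)⁻¹ • V (0, y) = _
    have : V (0, y) = (y.1.1 : EuclideanSpace ℝ (Fin (k + 1))) := by simp [hV]
    rw [this, norm_eq_of_mem_sphere, inv_one, one_smul]
  have hH1 : ∀ y, H (1, y) = y := by
    intro y
    apply Subtype.ext
    change (y.1.1, γ (1, y)) = y.1
    refine Prod.ext rfl ?_
    apply Subtype.ext
    change (‖V (1, y)‖)⁻¹ • V (1, y) = _
    have : V (1, y) = (y.1.2 : EuclideanSpace ℝ (Fin (k + 1))) := by simp [hV]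
    rw [this, norm_eq_of_mem_sphere, inv_one, one_smul]
  have hleft : (g.comp f).Homotopic (ContinuousMap.id _) :=
    ⟨{ toContinuousMap := H, map_zero_left := hH0, map_one_left := hH1 }⟩
  exact ⟨{ toFun := f, invFun := g, left_inv := hleft, right_inv := ContinuousMap.Homotopic.refl _ },
    fun y => rfl, fun p => rfl⟩

/-- **The diagonal `Sᵏ → N_c°` is a homology isomorphism.** [cite: HatcherAT2002, Cor. 2.11] -/
theorem isIso_map_diag (hc0 : -1 ≤ c) (hc1 : c < 1) (j : ℕ) :
    IsIso (singularHomology.map ℤ ℤ (⟨fun p => ⟨(p, p), diagonal_subset_openTube hc1 rfl⟩, by fun_prop⟩ :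
      C(Metric.sphere (0 : EuclideanSpace ℝ (Fin (k + 1))) 1, ↥(openTube k c))) j) := by
  obtain ⟨e, -, he⟩ := exists_homotopyEquiv_sphere (k := k) hc0 hc1
  have h := isIso_map_of_homotopyEquiv ℤ ℤ e.symm j
  have : (e.symm.toFun : C(_, ↥(openTube k c))) =
      ⟨fun p => ⟨(p, p), diagonal_subset_openTube hc1 rfl⟩, by fun_prop⟩ := by
    ext p : 1; exact he p
  rwa [this] at h

/-- **The projection `(p, q) ↦ p` is a homology isomorphism `Hⱼ(N_c°) ≅ Hⱼ(Sᵏ)`.**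
[cite: HatcherAT2002, Cor. 2.11] -/
theorem isIso_map_fst (hc0 : -1 ≤ c) (hc1 : c < 1) (j : ℕ) :
    IsIso (singularHomology.map ℤ ℤ (⟨fun y => y.1.1, continuous_fst.comp continuous_subtype_val⟩ :
      C(↥(openTube k c), Metric.sphere (0 : EuclideanSpace ℝ (Fin (k + 1))) 1)) j) := by
  obtain ⟨e, he, -⟩ := exists_homotopyEquiv_sphere (k := k) hc0 hc1
  have h := isIso_map_of_homotopyEquiv ℤ ℤ e j
  have : (e.toFun : C(↥(openTube k c), _)) =
      ⟨fun y => y.1.1, continuous_fst.comp continuous_subtype_val⟩ := by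
    ext y : 1; exact he y
  rwa [this] at h

/-- **`Hⱼ(N_c°; ℤ) = 0` for `j ∉ {0, k}`.** [cite: HatcherAT2002, Cor. 2.11, Cor. 2.14] -/
theorem isZero_singularHomology (hc0 : -1 ≤ c) (hc1 : c < 1) {j : ℕ} (hj0 : j ≠ 0) (hjk : j ≠ k) :
    IsZero (singularHomology ℤ ℤ ↥(openTube k c) j) := by
  obtain ⟨e, -, -⟩ := exists_homotopyEquiv_sphere (k := k) hc0 hc1
  haveI := isIso_map_of_homotopyEquiv ℤ ℤ e j
  exact (isZero_singularHomology_sphere_holds ℤ ℤ hj0 hjk).of_iso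
    (asIso (singularHomology.map ℤ ℤ (e.toFun) j))

/-- **`Hₖ(N_c°; ℤ) = ℤ · diag₊[S]`** (`k ≥ 2`, `-1 ≤ c < 1`): the core sphere generates.
[cite: Kosinski1993, VI.12] [cite: HatcherAT2002, Cor. 2.11] -/
theorem exists_eq_zsmul_map_diag (hk : 2 ≤ k) (hc0 : -1 ≤ c) (hc1 : c < 1)
    (y : singularHomology ℤ ℤ ↥(openTube k c) k) :
    ∃ m : ℤ, y = m • singularHomology.map ℤ ℤ
      (⟨fun p => ⟨(p, p), diagonal_subset_openTube hc1 rfl⟩, by fun_prop⟩ :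
        C(Metric.sphere (0 : EuclideanSpace ℝ (Fin (k + 1))) 1, ↥(openTube k c))) k
      (μS hk).fundamentalClass := by
  haveI := isIso_map_diag (k := k) hc0 hc1 k
  exact exists_eq_zsmul_map_of_isIso hk _ y

/-- The same for **any space `U` homeomorphic to the open tube**, with the core sphere
`ψ ∘ diag` (an open piece `Uᵥ ≅ N_c°` of the plumbing). [cite: Kosinski1993, VI.12] -/
theorem exists_eq_zsmul_map_homeomorph_diag (hk : 2 ≤ k) (hc0 : -1 ≤ c) (hc1 : c < 1)
    {U : Type} [TopologicalSpace U] (ψ : ↥(openTube k c) ≃ₜ U) (y : singularHomology ℤ ℤ U k) :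
    ∃ m : ℤ, y = m • singularHomology.map ℤ ℤ
      ((ψ : C(↥(openTube k c), U)).comp (⟨fun p => ⟨(p, p), diagonal_subset_openTube hc1 rfl⟩, by fun_prop⟩ :
        C(Metric.sphere (0 : EuclideanSpace ℝ (Fin (k + 1))) 1, ↥(openTube k c)))) k
      (μS hk).fundamentalClass := by
  haveI := isIso_map_diag (k := k) hc0 hc1 k
  haveI : IsIso (singularHomology.map ℤ ℤ (ψ : C(↥(openTube k c), U)) k) :=
    (singularHomology.mapIso ℤ ℤ ψ k).isIso_hom
  haveI : IsIso (singularHomology.map ℤ ℤ ((ψ : C(↥(openTube k c), U)).comp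
      (⟨fun p => ⟨(p, p), diagonal_subset_openTube hc1 rfl⟩, by fun_prop⟩ :
        C(Metric.sphere (0 : EuclideanSpace ℝ (Fin (k + 1))) 1, ↥(openTube k c)))) k) := by
    rw [singularHomology.map_comp]; infer_instance
  exact exists_eq_zsmul_map_of_isIso hk _ y

end OpenTube

end SphereProd

end Literature.Topology.FourManifolds
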